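import Literature.LinearAlgebra.Matrix.TransferMatrixSpectralWeights

/-!
# Primitive nonnegative symmetric matrices: reachability, a positive power, and simplicity of
# the largest eigenvalue (Perron–Frobenius via a positive power)

Topic `LinearAlgebra/Matrix`, namespace `Literature.LinearAlgebra.Matrix`; continues
`PerronSymmetric.lean` (Perron's theorem for symmetric matrices with *strictly positive* entries,
Ding–Zhou 2009, Thm 2.1) and `NonnegSymmetricTraceLimit.lean`. For a real symmetric matrix `A`
with entries `≥ 0` and positive diagonal:

* `Reach A i j` (`∃ m, (A^m)_{ij} > 0`) is an equivalence relation (`A` symmetric) containing the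
  positivity graph of `A`; if all pairs are reachable ("irreducible", a "single block") then, the
  diagonal being positive (aperiodicity), **some power `A^m` is entrywise positive**
  (`exists_pow_apply_pos`).
* `card_filter_eigenvalues_eq_topEigenvalue_eq_one_of_pow_pos`: if some power of `A` is entrywise
  positive then **the largest eigenvalue `Λ` of `A` is simple**, and
  `exists_pos_eigenvector_of_pow_pos`: it has an eigenvector with positive entries
  — Perron's theorem (Ding–Zhou Thm 2.1 (i)–(ii)) applied to the positive symmetric matrix `A^m`,
  whose largest eigenvalue is `Λ^m` (`topEigenvalue_pow_eq`), combined with `-Λ < λ_i ≤ Λ`.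

This is the content of DKLM 2026, Lemma 57 ("`t(π/2)` is a Hermitian Perron–Frobenius matrix
with a single block […] `t(π/2)^k` has positive entries for sufficiently large `k` […] the
eigenspace of the top eigenvalue is one-dimensional, `v_0` may be chosen with positive entries")
at the level of matrices; the six-vertex input (irreducibility of the transfer matrix on balanced
column states) is supplied in `Literature/Probability/LatticeModels/SixVertexTransferMatrixPerron.lean`.

## References

* J. Ding, A. Zhou, *Nonnegative Matrices, Positive Operators, and Applications* (2009), §2.1,
  Theorem 2.1 (Perron) and the Perron–Frobenius theorem for irreducible matrices. [DingZhou2009]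
* H. Duminil-Copin, K. K. Kozlowski, P. Lammers, I. Manolescu, arXiv:2603.06268 (2026), Part III
  §1, Lemma 57 and Remark 58. [DKLM2026SixVertexGFF]
-/

noncomputable section

open Matrix Finset Filter Topology

namespace Literature.LinearAlgebra.Matrix

variable {n : Type*} [Fintype n] [DecidableEq n] {A : Matrix n n ℝ}

/-! ### Entries of powers of a nonnegative matrix -/

/-- Powers of an entrywise nonnegative matrix are entrywise nonnegative. [folklore] -/
theorem pow_apply_nonneg (hA0 : ∀ i j, 0 ≤ A i j) (m : ℕ) (i j : n) : 0 ≤ (A ^ m) i j := by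
  induction m generalizing i j with
  | zero =>
    rw [pow_zero, Matrix.one_apply]
    split_ifs <;> norm_num
  | succ m ih =>
    rw [pow_succ, Matrix.mul_apply]
    exact Finset.sum_nonneg fun l _ => mul_nonneg (ih i l) (hA0 l j)

/-- Super-multiplicativity of entries of powers: `(A^m)_{ij} (A^{m'})_{jk} ≤ (A^{m+m'})_{ik}`.
[folklore] -/
theorem pow_apply_mul_pow_apply_le (hA0 : ∀ i j, 0 ≤ A i j) (m m' : ℕ) (i j k : n) :
    (A ^ m) i j * (A ^ m') j k ≤ (A ^ (m + m')) i k := by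
  rw [pow_add, Matrix.mul_apply]
  exact Finset.single_le_sum (f := fun l => (A ^ m) i l * (A ^ m') l k)
    (fun l _ => mul_nonneg (pow_apply_nonneg hA0 m i l) (pow_apply_nonneg hA0 m' l k))
    (Finset.mem_univ j)

/-- With a positive diagonal, diagonal entries of all powers are positive. [folklore] -/
theorem pow_apply_self_pos (hA0 : ∀ i j, 0 ≤ A i j) (hdiag : ∀ i, 0 < A i i) (m : ℕ) (i : n) :
    0 < (A ^ m) i i := by
  induction m with
  | zero => rw [pow_zero, Matrix.one_apply_eq]; exact one_pos
  | succ m ih =>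
    have h := pow_apply_mul_pow_apply_le hA0 m 1 i i i
    rw [pow_one] at h
    exact (mul_pos ih (hdiag i)).trans_le h

/-- With a positive diagonal, a positive entry of `A^m` stays positive in `A^{m'}`, `m' ≥ m`
(aperiodicity). [folklore] -/
theorem pow_apply_pos_mono (hA0 : ∀ i j, 0 ≤ A i j) (hdiag : ∀ i, 0 < A i i) {i j : n}
    {m m' : ℕ} (hmm : m ≤ m') (h : 0 < (A ^ m) i j) : 0 < (A ^ m') i j := by
  obtain ⟨d, rfl⟩ := Nat.exists_eq_add_of_le hmm
  exact (mul_pos h (pow_apply_self_pos hA0 hdiag d j)).trans_le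
    (pow_apply_mul_pow_apply_le hA0 m d i j j)

/-! ### Reachability in the positivity graph -/

/-- **Reachability**: `j` is reachable from `i` if some power of `A` has a positive `(i, j)` entry
(a path of positive entries). [folklore] -/
def Reach (A : Matrix n n ℝ) (i j : n) : Prop :=
  ∃ m : ℕ, 0 < (A ^ m) i j

/-- Reachability is reflexive. [folklore] -/
theorem reach_refl (A : Matrix n n ℝ) (i : n) : Reach A i i :=
  ⟨0, by rw [pow_zero, Matrix.one_apply_eq]; exact one_pos⟩

/-- A positive entry is a one-step path. [folklore] -/
theorem reach_of_pos {i j : n} (h : 0 < A i j) : Reach A i j :=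
  ⟨1, by rwa [pow_one]⟩

/-- Reachability is transitive (nonnegative entries). [folklore] -/
theorem Reach.trans (hA0 : ∀ i j, 0 ≤ A i j) {i j k : n} (h₁ : Reach A i j) (h₂ : Reach A j k) :
    Reach A i k := by
  obtain ⟨m, hm⟩ := h₁
  obtain ⟨m', hm'⟩ := h₂
  exact ⟨m + m', (mul_pos hm hm').trans_le (pow_apply_mul_pow_apply_le hA0 m m' i j k)⟩

/-- Reachability is symmetric for a symmetric matrix. [folklore] -/
theorem Reach.symm (hAs : A.IsSymm) {i j : n} (h : Reach A i j) : Reach A j i := by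
  obtain ⟨m, hm⟩ := h
  refine ⟨m, ?_⟩
  have h2 : (A ^ m) j i = (A ^ m) i j := by
    conv_lhs => rw [← hAs.pow m]
    rfl
  rwa [h2]

/-- **Irreducible + positive diagonal ⇒ primitive**: if every pair is reachable then some power
of `A` is entrywise positive (Lemma 57: "`t(π/2)^k` has positive entries for sufficiently large
`k`; as a consequence, it has a single block"). [cite: DKLM2026SixVertexGFF, Lemma 57] -/
theorem exists_pow_apply_pos (hA0 : ∀ i j, 0 ≤ A i j) (hdiag : ∀ i, 0 < A i i)
    (hreach : ∀ i j, Reach A i j) : ∃ m : ℕ, ∀ i j, 0 < (A ^ m) i j := by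
  classical
  choose m hm using hreach
  refine ⟨Finset.univ.sup fun p : n × n => m p.1 p.2, fun i j => ?_⟩
  exact pow_apply_pos_mono hA0 hdiag
    (Finset.le_sup (f := fun p : n × n => m p.1 p.2) (Finset.mem_univ (i, j))) (hm i j)

/-! ### The largest eigenvalue of a power -/

/-- The quadratic form of `A^M` in spectral coordinates: `xᵀ A^M x = ∑ᵢ λᵢ^M yᵢ²`, `y = Uᵀx`.
[folklore] -/
theorem dotProduct_pow_mulVec_eq_sum (hA : A.IsHermitian) (M : ℕ) (x : n → ℝ) :
    x ⬝ᵥ (A ^ M *ᵥ x) = ∑ i, hA.eigenvalues i ^ M * (star (eigU hA) *ᵥ x) i ^ 2 := by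
  rw [pow_eq_eigU_mul hA M, ← mulVec_mulVec, ← mulVec_mulVec, dotProduct_eigU_mulVec, dotProduct]
  refine sum_congr rfl fun i _ => ?_
  rw [mulVec_diagonal]
  ring

/-- Powers act on eigenvectors by powers of the eigenvalue. [folklore] -/
theorem pow_mulVec_of_mulVec_eq_smul {v : n → ℝ} {μ : ℝ} (h : A *ᵥ v = μ • v) (m : ℕ) :
    A ^ m *ᵥ v = μ ^ m • v := by
  induction m with
  | zero => rw [pow_zero, pow_zero, one_mulVec, one_smul]
  | succ m ih => rw [pow_succ, ← mulVec_mulVec, h, mulVec_smul, ih, smul_smul, pow_succ']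

/-- For a symmetric matrix with nonnegative off-diagonal entries and diagonal `≥ δ > 0`
(so that `-Λ < λ_i ≤ Λ`): **the largest eigenvalue of `A^m` is `Λ^m`**. [folklore] -/
theorem topEigenvalue_pow_eq [Nonempty n] (hA : A.IsHermitian) (hA0 : ∀ i j, i ≠ j → 0 ≤ A i j)
    {δ : ℝ} (hδ : 0 < δ) (hdiag : ∀ i, δ ≤ A i i) (m : ℕ) :
    topEigenvalue (hA.pow m) = topEigenvalue hA ^ m := by
  have hΛ : 0 < topEigenvalue hA := topEigenvalue_pos_of_diag hA hδ hdiag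
  have hpow_le : ∀ i, hA.eigenvalues i ^ m ≤ topEigenvalue hA ^ m := fun i => by
    have h1 := eigenvalues_le_topEigenvalue hA i
    have h2 : -topEigenvalue hA ≤ hA.eigenvalues i := by
      have h := neg_one_lt_eigenvalues_div_topEigenvalue hA hA0 hδ hdiag i
      rw [lt_div_iff₀ hΛ] at h
      linarith
    calc hA.eigenvalues i ^ m ≤ |hA.eigenvalues i| ^ m := by
          rw [← abs_pow]; exact le_abs_self _
      _ ≤ topEigenvalue hA ^ m := pow_le_pow_left₀ (abs_nonneg _) (abs_le.2 ⟨h2, h1⟩) m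
  apply le_antisymm
  · obtain ⟨i₁, hi₁⟩ := exists_eigenvalues_eq_topEigenvalue (hA.pow m)
    have hww := eigenvectorBasis_dotProduct (hA.pow m) i₁ i₁
    rw [if_pos rfl] at hww
    have hBw : ((hA.pow m).eigenvectorBasis i₁).ofLp ⬝ᵥ (A ^ m *ᵥ ((hA.pow m).eigenvectorBasis i₁).ofLp) =
        topEigenvalue (hA.pow m) := by
      rw [(hA.pow m).mulVec_eigenvectorBasis i₁, dotProduct_smul, hww, hi₁, smul_eq_mul, mul_one]
    rw [← hBw, dotProduct_pow_mulVec_eq_sum hA m]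
    calc ∑ i, hA.eigenvalues i ^ m * (star (eigU hA) *ᵥ ((hA.pow m).eigenvectorBasis i₁).ofLp) i ^ 2
        ≤ ∑ i, topEigenvalue hA ^ m * (star (eigU hA) *ᵥ ((hA.pow m).eigenvectorBasis i₁).ofLp) i ^ 2 :=
          Finset.sum_le_sum fun i _ => mul_le_mul_of_nonneg_right (hpow_le i) (sq_nonneg _)
      _ = topEigenvalue hA ^ m *
            (((hA.pow m).eigenvectorBasis i₁).ofLp ⬝ᵥ ((hA.pow m).eigenvectorBasis i₁).ofLp) := by
          rw [dotProduct_self_eq_sum hA, Finset.mul_sum]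
      _ = topEigenvalue hA ^ m := by rw [hww, mul_one]
  · obtain ⟨i₀, hi₀⟩ := exists_eigenvalues_eq_topEigenvalue hA
    have hvv := eigenvectorBasis_dotProduct hA i₀ i₀
    rw [if_pos rfl] at hvv
    have hAv : A *ᵥ (hA.eigenvectorBasis i₀).ofLp = topEigenvalue hA • (hA.eigenvectorBasis i₀).ofLp := by
      rw [hA.mulVec_eigenvectorBasis i₀, hi₀]
    have h := dotProduct_mulVec_le (hA.pow m) (hA.eigenvectorBasis i₀).ofLp
    rw [pow_mulVec_of_mulVec_eq_smul hAv m, dotProduct_smul, hvv, smul_eq_mul, mul_one, mul_one] at h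
    exact h

/-! ### Perron–Frobenius through a positive power -/

omit [DecidableEq n] in
/-- A positive vector has positive squared norm. [folklore] -/
theorem dotProduct_self_pos_of_pos [Nonempty n] {u : n → ℝ} (hu : ∀ i, 0 < u i) : 0 < u ⬝ᵥ u := by
  rw [dotProduct]
  exact Finset.sum_pos (fun i _ => mul_pos (hu i) (hu i)) Finset.univ_nonempty

/-- **Simplicity of the largest eigenvalue** (Lemma 57 / Remark 58: "the eigenspace of `T(π/2)`
associated with the top eigenvalue `1` is one-dimensional"): if `A` is symmetric with nonnegative
entries and positive diagonal and some power `A^m` is entrywise positive, then `Λ = λ_max(A)` is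
listed exactly once. Proof: Perron's theorem (ii) for the positive symmetric matrix `A^m`, whose
largest eigenvalue is `Λ^m`; two orthonormal eigenvectors of `A` for `Λ` would both be multiples
of the positive Perron vector of `A^m`. [cite: DKLM2026SixVertexGFF, Lemma 57 and Remark 58] -/
theorem card_filter_eigenvalues_eq_topEigenvalue_eq_one_of_pow_pos [Nonempty n] (hA : A.IsHermitian)
    (hA0 : ∀ i j, i ≠ j → 0 ≤ A i j) {δ : ℝ} (hδ : 0 < δ) (hdiag : ∀ i, δ ≤ A i i) {m : ℕ}
    (hpos : ∀ i j, 0 < (A ^ m) i j) :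
    (univ.filter fun i => hA.eigenvalues i = topEigenvalue hA).card = 1 := by
  have hBtop := topEigenvalue_pow_eq hA hA0 hδ hdiag m
  obtain ⟨u, hu, hBu⟩ := exists_pos_eigenvector (hA.pow m) hpos
  -- every top eigenvector of `A` is a multiple of the Perron vector `u` of `A^m`
  have key : ∀ i, hA.eigenvalues i = topEigenvalue hA →
      ∃ c : ℝ, (hA.eigenvectorBasis i).ofLp = c • u := by
    intro i hi
    have hAv : A *ᵥ (hA.eigenvectorBasis i).ofLp = topEigenvalue hA • (hA.eigenvectorBasis i).ofLp := by
      rw [hA.mulVec_eigenvectorBasis i, hi]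
    refine eq_smul_of_mulVec_eq_topEigenvalue (hA.pow m) hpos hu hBu ?_
    rw [hBtop]
    exact pow_mulVec_of_mulVec_eq_smul hAv m
  obtain ⟨i₀, hi₀⟩ := exists_eigenvalues_eq_topEigenvalue hA
  rw [Finset.card_eq_one]
  refine ⟨i₀, Finset.eq_singleton_iff_unique_mem.2 ⟨by simp [hi₀], fun j hj => ?_⟩⟩
  simp only [Finset.mem_filter, Finset.mem_univ, true_and] at hj
  by_contra hne
  obtain ⟨c₀, hc₀⟩ := key i₀ hi₀
  obtain ⟨c₁, hc₁⟩ := key j hj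
  have huu : 0 < u ⬝ᵥ u := dotProduct_self_pos_of_pos hu
  -- orthogonality of `v_j` and `v_{i₀}` forces `c₁ c₀ = 0`
  have horth := eigenvectorBasis_dotProduct hA j i₀
  rw [if_neg hne, hc₀, hc₁, smul_dotProduct, dotProduct_smul, smul_eq_mul, smul_eq_mul] at horth
  have hc : c₁ * c₀ = 0 := by
    have h : c₁ * c₀ * (u ⬝ᵥ u) = 0 := by rw [mul_assoc]; exact horth
    exact (mul_eq_zero.1 h).resolve_right huu.ne'
  -- but both are unit vectors, so `c₀, c₁ ≠ 0`
  have hunit : ∀ {i : n} {c : ℝ}, (hA.eigenvectorBasis i).ofLp = c • u → c ≠ 0 := by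
    intro i c hc h0
    have h := eigenvectorBasis_dotProduct hA i i
    rw [if_pos rfl, hc, h0, zero_smul, dotProduct_zero] at h
    exact zero_ne_one h
  rcases mul_eq_zero.1 hc with h | h
  · exact hunit hc₁ h
  · exact hunit hc₀ h

/-- **A positive eigenvector for the largest eigenvalue** (Lemma 57: "`v_0` may be chosen such
that it has positive real entries"), under the same hypotheses. [cite: DKLM2026SixVertexGFF, Lemma 57] -/
theorem exists_pos_eigenvector_of_pow_pos [Nonempty n] (hA : A.IsHermitian)
    (hA0 : ∀ i j, i ≠ j → 0 ≤ A i j) {δ : ℝ} (hδ : 0 < δ) (hdiag : ∀ i, δ ≤ A i i) {m : ℕ}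
    (hpos : ∀ i j, 0 < (A ^ m) i j) :
    ∃ v : n → ℝ, (∀ i, 0 < v i) ∧ A *ᵥ v = topEigenvalue hA • v := by
  have hBtop := topEigenvalue_pow_eq hA hA0 hδ hdiag m
  obtain ⟨u, hu, hBu⟩ := exists_pos_eigenvector (hA.pow m) hpos
  obtain ⟨i₀, hi₀⟩ := exists_eigenvalues_eq_topEigenvalue hA
  have hAv : A *ᵥ (hA.eigenvectorBasis i₀).ofLp = topEigenvalue hA • (hA.eigenvectorBasis i₀).ofLp := by
    rw [hA.mulVec_eigenvectorBasis i₀, hi₀]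
  obtain ⟨c, hc⟩ : ∃ c : ℝ, (hA.eigenvectorBasis i₀).ofLp = c • u := by
    refine eq_smul_of_mulVec_eq_topEigenvalue (hA.pow m) hpos hu hBu ?_
    rw [hBtop]
    exact pow_mulVec_of_mulVec_eq_smul hAv m
  have hc0 : c ≠ 0 := by
    intro h0
    have h := eigenvectorBasis_dotProduct hA i₀ i₀
    rw [if_pos rfl, hc, h0, zero_smul, dotProduct_zero] at h
    exact zero_ne_one h
  refine ⟨u, hu, ?_⟩
  have hu_eq : u = c⁻¹ • (hA.eigenvectorBasis i₀).ofLp := by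
    rw [hc, smul_smul, inv_mul_cancel₀ hc0, one_smul]
  rw [hu_eq, mulVec_smul, hAv, smul_comm]

end Literature.LinearAlgebra.Matrix

end
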